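import Literature.Dynamics.SymbolicDynamics.DistortionGlueCore
import Literature.Dynamics.SymbolicDynamics.AperiodicSFT
import HarnessLib

/-!
# The distortion operator and gluing: from nets to columns to blocks

The two gluing statements of Gangloff–Sablik §5.4.3 about the distortion operator `d_A`
(`DistortionOperator.lean`), obtained from the gluing construction (`core_gap`, `core_level` of
`DistortionGlueCore.lean`):

* `colGluing_distortion` — if `Y` is (linearly) **net gluing** then `d_A(Y)` is **column
  gluing**: two `n`-blocks glue at every offset `u` of norm `≥ C n` whose first coordinate lies
  in a residue class modulo a period `N ≤ C n` (Lemma 10: "the set of integers `k` such that …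
  contains some regularly displayed columns");
* `rowGluing_rotSet` — rotating by a quarter turn exchanges columns and rows;
* `isLinearlyBlockGluing_distortion` — if `Y` is **row gluing** then `d_A(Y)` is **linearly
  block gluing** (end of the proof of Thm. 26).

Also: `d_A(Y)` is shift-invariant when `Y` is (`isShiftInvariant_distortion`), and the
elementary transfers through the rotation (`isSFT_rotSet`, `isAperiodic_rotSet`, …).

## References

* S. Gangloff, M. Sablik, *Quantified block gluing for multidimensional subshifts of finite type:
  aperiodicity and entropy*, J. Anal. Math. 144 (2021), §5.4.3, Lemma 10 and proof of Thm. 26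
  (arXiv:1706.01627).
-/

namespace Literature.Dynamics.SymbolicDynamics.Distortion

open _root_.SymbolicDynamics.FullShift
open Literature.Dynamics.SymbolicDynamics (square mem_square IsShiftInvariant IsSFT IsAperiodic
  blockGluingSet IsBlockGluing IsLinearlyBlockGluing)

variable {A B : Type*}

/-! ### `d_A(Y)` is shift-invariant -/

section ShiftInv

variable {z : ℤ × ℤ → Option A} (v : ℤ × ℤ)

/-- The rules are translation invariant. [cite: GangloffSablik2021, §5.4.1 (arXiv numbering)] -/
theorem IsDelta.shift (hz : IsDelta z) (v : ℤ × ℤ) : IsDelta (shift v z) := by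
  obtain ⟨v1, v2⟩ := v
  refine ⟨fun i j h => ?_, fun i j h1 h2 => ?_, fun i j h1 h2 => ?_⟩ <;>
    simp only [shift_apply, Prod.mk_add_mk] at *
  · have := hz.below_ne_none (v1 + i) (v2 + j) h
    rwa [show v2 + (j - 1) = v2 + j - 1 by ring]
  · have := hz.left_rule (v1 + i) (v2 + j) (by rwa [show v1 + i + 1 = v1 + (i + 1) by ring]) h2
    rwa [show v2 + (j - 1) = v2 + j - 1 by ring]
  · have := hz.right_rule (v1 + i) (v2 + j) h1 (by rwa [show v1 + i + 1 = v1 + (i + 1) by ring])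
    rwa [show v1 + (i + 1) = v1 + i + 1 by ring, show v2 + (j + 1) = v2 + j + 1 by ring]

/-- Translation of `→`-cells from `shift v z` to `z`. [folklore] -/
def tauRC (c : RC (shift v z)) : RC z :=
  ⟨v + c.1, c.2⟩

/-- [folklore] -/
@[simp] theorem tauRC_val (c : RC (shift v z)) : (tauRC v c).1 = v + c.1 := rfl

/-- [cite: GangloffSablik2021, §5.4.1 (arXiv numbering)] -/
theorem succPerm_tau (hz : IsDelta z) (c : RC (shift v z)) :
    succPerm hz (tauRC v c) = tauRC v (succPerm (hz.shift v) c) := by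
  apply Subtype.ext
  show (succFun hz (tauRC v c)).1 = v + (succFun (hz.shift v) c).1
  obtain ⟨v1, v2⟩ := v
  have key : z (v1 + c.1.1 + 1, v2 + c.1.2) = shift (v1, v2) z (c.1.1 + 1, c.1.2) := by
    rw [shift_apply, Prod.mk_add_mk, add_assoc]
  by_cases h : shift (v1, v2) z (c.1.1 + 1, c.1.2) = none
  · rw [succFun_val_of_eq_none _ c h, succFun_val_of_eq_none hz _ (by simpa [key] using h)]
    simp only [tauRC_val, Prod.mk_add_mk, Prod.fst_add, Prod.snd_add]
    refine Prod.ext ?_ ?_ <;> omega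
  · rw [succFun_val_of_ne_none _ c h, succFun_val_of_ne_none hz _ (by simpa [key] using h)]
    simp only [tauRC_val, Prod.mk_add_mk, Prod.fst_add, Prod.snd_add]
    refine Prod.ext ?_ ?_ <;> omega

/-- [cite: GangloffSablik2021, §5.4.1 (arXiv numbering)] -/
theorem nxtPerm_tau (hz : IsDelta z) (c : RC (shift v z)) :
    nxtPerm hz (tauRC v c) = tauRC v (nxtPerm (hz.shift v) c) := by
  apply Subtype.ext
  show (nxtFun hz (tauRC v c)).1 = v + (nxtFun (hz.shift v) c).1
  obtain ⟨v1, v2⟩ := v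
  have key : z (v1 + c.1.1, v2 + c.1.2 + 1) = shift (v1, v2) z (c.1.1, c.1.2 + 1) := by
    rw [shift_apply, Prod.mk_add_mk, add_assoc]
  by_cases h : shift (v1, v2) z (c.1.1, c.1.2 + 1) = none
  · rw [nxtFun_val_of_eq_none _ c h, nxtFun_val_of_eq_none hz _ (by simpa [key] using h)]
    simp only [tauRC_val, Prod.mk_add_mk, Prod.fst_add, Prod.snd_add]
    refine Prod.ext ?_ ?_ <;> omega
  · rw [nxtFun_val_of_ne_none _ c h, nxtFun_val_of_ne_none hz _ (by simpa [key] using h)]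
    simp only [tauRC_val, Prod.mk_add_mk, Prod.fst_add, Prod.snd_add]
    refine Prod.ext ?_ ?_ <;> omega

/-- [cite: GangloffSablik2021, §5.4.1 (arXiv numbering)] -/
theorem succPerm_zpow_tau (hz : IsDelta z) (m : ℤ) (c : RC (shift v z)) :
    (succPerm hz ^ m) (tauRC v c) = tauRC v ((succPerm (hz.shift v) ^ m) c) := by
  induction m using Int.induction_on generalizing c with
  | zero => simp
  | succ m ih =>
    rw [zpow_add_one, zpow_add_one, Equiv.Perm.mul_apply, Equiv.Perm.mul_apply, succPerm_tau, ih]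
  | pred m ih =>
    have hs : ∀ e, (succPerm hz).symm (tauRC v e) = tauRC v ((succPerm (hz.shift v)).symm e) := by
      intro e; rw [Equiv.symm_apply_eq, succPerm_tau v hz, Equiv.apply_symm_apply]
    rw [zpow_sub_one, zpow_sub_one, Equiv.Perm.mul_apply, Equiv.Perm.mul_apply, Equiv.Perm.inv_def,
      Equiv.Perm.inv_def, hs, ih]

/-- [cite: GangloffSablik2021, §5.4.1 (arXiv numbering)] -/
theorem nxtPerm_zpow_tau (hz : IsDelta z) (m : ℤ) (c : RC (shift v z)) :
    (nxtPerm hz ^ m) (tauRC v c) = tauRC v ((nxtPerm (hz.shift v) ^ m) c) := by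
  induction m using Int.induction_on generalizing c with
  | zero => simp
  | succ m ih =>
    rw [zpow_add_one, zpow_add_one, Equiv.Perm.mul_apply, Equiv.Perm.mul_apply, nxtPerm_tau, ih]
  | pred m ih =>
    have hs : ∀ e, (nxtPerm hz).symm (tauRC v e) = tauRC v ((nxtPerm (hz.shift v)).symm e) := by
      intro e; rw [Equiv.symm_apply_eq, nxtPerm_tau v hz, Equiv.apply_symm_apply]
    rw [zpow_sub_one, zpow_sub_one, Equiv.Perm.mul_apply, Equiv.Perm.mul_apply, Equiv.Perm.inv_def,
      Equiv.Perm.inv_def, hs, ih]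

/-- **The curves of `shift v z` are the curves of `z` translated**, with curve numbers shifted by
a constant. [cite: GangloffSablik2021, §5.4.1 (arXiv numbering)] -/
theorem exists_curvePt_tau (hz : IsDelta z) : ∃ κ : ℤ, ∀ i k : ℤ,
    (curvePt hz (i + v.1) (κ + k)).1 = v + (curvePt (hz.shift v) i k).1 := by
  obtain ⟨κ, hκ⟩ := exists_curvePt_eq hz (tauRC v (base (hz.shift v)))
  simp only [tauRC_val, Prod.fst_add, base_col, add_zero] at hκ
  refine ⟨κ, fun i k => ?_⟩
  rw [curvePt_add_left, curvePt_add_right, hκ, nxtPerm_zpow_tau, succPerm_zpow_tau]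
  rfl

/-- **A translate of a configuration of `d_A(Y)` is in `d_A(Y)`** (`Y` shift-invariant).
[cite: GangloffSablik2021, §5.4.2 (arXiv numbering)] -/
theorem shift_mem_distortion {Y : Set (ℤ × ℤ → A)} (hY : IsShiftInvariant Y)
    (h : z ∈ distortion Y) : shift v z ∈ distortion Y := by
  obtain ⟨hz, x, hx, hP⟩ := h
  obtain ⟨κ, hκ⟩ := exists_curvePt_tau v hz
  refine ⟨hz.shift v, shift (v.1, κ) x, hY.shift_mem _ hx, fun i k => ?_⟩
  have := hP (i + v.1) (κ + k)
  rw [hκ] at this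
  rw [shift_apply, this, shift_apply]
  congr 2
  ext <;> simp [add_comm]

end ShiftInv

/-- **`d_A(Y)` is shift-invariant** when `Y` is. [cite: GangloffSablik2021, §5.4.2 (arXiv numbering)] -/
theorem isShiftInvariant_distortion {Y : Set (ℤ × ℤ → A)} (hY : IsShiftInvariant Y) :
    IsShiftInvariant (distortion Y) :=
  fun v _ hz => shift_mem_distortion v hY hz

/-! ### The gluing properties involved -/

/-- `Y` is **linearly net gluing** (strong form, as for the Ollinger subshift): for every `m ≥ 1`
there is `N ≤ C m` such that for any `x₁, x₂ ∈ Y` some `w` and ONE `y ∈ Y` has the `m`-block of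
`x₁` at the origin and that of `x₂` at all positions `w + N ℤ²`.
[cite: GangloffSablik2021, Def. 13 (strong form)] -/
def NetGluing (Y : Set (ℤ × ℤ → A)) (C : ℕ) : Prop :=
  ∀ m : ℕ, 1 ≤ m → ∃ N : ℕ, 1 ≤ N ∧ N ≤ C * m ∧ ∀ x₁ ∈ Y, ∀ x₂ ∈ Y, ∃ w : ℤ × ℤ, ∃ y ∈ Y,
    (∀ s ∈ square m, y s = x₁ s) ∧
      ∀ t : ℤ × ℤ, ∀ s ∈ square m, y (w + ((N : ℤ) * t.1, (N : ℤ) * t.2) + s) = x₂ s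

/-- `Z` is **linearly column gluing**: for `n ≥ 1` and `z₁, z₂ ∈ Z` there are a period
`1 ≤ N ≤ C n` and a phase `φ` such that the `n`-blocks of `z₁`, `z₂` glue at every offset `u`
with `‖u‖_∞ ≥ C n` and `u.1 ≡ φ (mod N)` ("regularly displayed columns").
[cite: GangloffSablik2021, §5.4.3 Lemma 10] -/
def ColGluing (Z : Set (ℤ × ℤ → B)) (C : ℕ) : Prop :=
  ∀ n : ℕ, 1 ≤ n → ∀ z₁ ∈ Z, ∀ z₂ ∈ Z, ∃ (N : ℕ) (φ : ℤ), 1 ≤ N ∧ N ≤ C * n ∧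
    ∀ u : ℤ × ℤ, (C * n : ℤ) ≤ max |u.1| |u.2| → (N : ℤ) ∣ u.1 - φ →
      ∃ z ∈ Z, (∀ s ∈ square n, z s = z₁ s) ∧ ∀ s ∈ square n, z (u + s) = z₂ s

/-- `Z` is **linearly row gluing**: the same with `u.2 ≡ φ (mod N)`.
[cite: GangloffSablik2021, §5.4.3 Lemma 10] -/
def RowGluing (Z : Set (ℤ × ℤ → B)) (C : ℕ) : Prop :=
  ∀ n : ℕ, 1 ≤ n → ∀ z₁ ∈ Z, ∀ z₂ ∈ Z, ∃ (N : ℕ) (φ : ℤ), 1 ≤ N ∧ N ≤ C * n ∧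
    ∀ u : ℤ × ℤ, (C * n : ℤ) ≤ max |u.1| |u.2| → (N : ℤ) ∣ u.2 - φ →
      ∃ z ∈ Z, (∀ s ∈ square n, z s = z₁ s) ∧ ∀ s ∈ square n, z (u + s) = z₂ s

/-! ### The quarter turn -/

/-- The quarter turn `(a, b) ↦ (-b, a)` of `ℤ²`. [folklore] -/
def rotM : ℤ × ℤ ≃+ ℤ × ℤ where
  toFun p := (-p.2, p.1)
  invFun p := (p.2, -p.1)
  left_inv p := by simp
  right_inv p := by simp
  map_add' p q := by simp only [Prod.fst_add, Prod.snd_add, Prod.mk_add_mk, neg_add]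

/-- [folklore] -/
@[simp] theorem rotM_apply (p : ℤ × ℤ) : rotM p = (-p.2, p.1) := rfl

/-- [folklore] -/
@[simp] theorem rotM_symm_apply (p : ℤ × ℤ) : rotM.symm p = (p.2, -p.1) := rfl

/-- **The rotated subshift** `ρ(Z) = {z ∘ ρ⁻¹ | z ∈ Z}`, in preimage form.
[cite: GangloffSablik2021, §5.4.3 (arXiv numbering)] -/
def rotSet (Z : Set (ℤ × ℤ → B)) : Set (ℤ × ℤ → B) :=
  {z' | z' ∘ rotM ∈ Z}

/-- [folklore] -/
@[simp] theorem mem_rotSet {Z : Set (ℤ × ℤ → B)} {z' : ℤ × ℤ → B} : z' ∈ rotSet Z ↔ z' ∘ rotM ∈ Z :=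
  Iff.rfl

/-- [folklore] -/
theorem isSFT_rotSet {Z : Set (ℤ × ℤ → B)} (h : IsSFT Z) : IsSFT (rotSet Z) :=
  h.comp_addEquiv rotM

/-- [folklore] -/
theorem rotSet_nonempty {Z : Set (ℤ × ℤ → B)} (h : Z.Nonempty) : (rotSet Z).Nonempty := by
  obtain ⟨z, hz⟩ := h
  refine ⟨z ∘ rotM.symm, ?_⟩
  rw [mem_rotSet]
  convert hz using 1
  ext p
  simp

/-- [folklore] -/
theorem shift_comp_rotM (u : ℤ × ℤ) (z' : ℤ × ℤ → B) :
    shift u z' ∘ rotM = shift (rotM.symm u) (z' ∘ rotM) := by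
  ext p
  obtain ⟨u1, u2⟩ := u
  obtain ⟨p1, p2⟩ := p
  simp only [Function.comp_apply, shift_apply, rotM_apply, rotM_symm_apply]
  congr 1
  exact Prod.ext (by simp only [Prod.mk_add_mk]; ring) (by simp only [Prod.mk_add_mk])

/-- [folklore] -/
theorem isShiftInvariant_rotSet {Z : Set (ℤ × ℤ → B)} (h : IsShiftInvariant Z) :
    IsShiftInvariant (rotSet Z) := by
  intro u z' hz'
  rw [mem_rotSet] at hz' ⊢
  rw [shift_comp_rotM]
  exact h.shift_mem _ hz'

/-- [folklore] -/
theorem isAperiodic_rotSet {Z : Set (ℤ × ℤ → B)} (h : IsAperiodic Z) : IsAperiodic (rotSet Z) := by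
  intro z' hz' u hu heq
  have h1 : shift (rotM.symm u) (z' ∘ rotM) = z' ∘ rotM := by rw [← shift_comp_rotM, heq]
  have hu' : rotM.symm u ≠ 0 := by
    intro h0
    apply hu
    have := congrArg rotM h0
    simp only [AddEquiv.apply_symm_apply, map_zero] at this
    exact this
  exact h _ hz' (rotM.symm u) hu' h1

/-- **Rotation turns column gluing into row gluing.** [cite: GangloffSablik2021, §5.4.3 (arXiv numbering), proof of Thm. 26] -/
theorem rowGluing_rotSet {Z : Set (ℤ × ℤ → B)} (hZ : IsShiftInvariant Z) {C : ℕ}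
    (h : ColGluing Z C) : RowGluing (rotSet Z) C := by
  intro n hn z₁' hz₁' z₂' hz₂'
  set v₀ : ℤ × ℤ := (0, -((n : ℤ) - 1)) with hv₀
  obtain ⟨N, φ, hN1, hNC, hglue⟩ := h n hn (shift v₀ (z₁' ∘ rotM)) (hZ.shift_mem v₀ hz₁')
    (shift v₀ (z₂' ∘ rotM)) (hZ.shift_mem v₀ hz₂')
  refine ⟨N, φ, hN1, hNC, fun u' hu' hdiv => ?_⟩
  obtain ⟨z, hz, hz1, hz2⟩ := hglue (rotM.symm u') (by simpa [max_comm] using hu') (by simpa using hdiv)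
  refine ⟨shift (-v₀) z ∘ rotM.symm, ?_, fun s hs => ?_, fun s hs => ?_⟩
  · rw [mem_rotSet]
    convert hZ.shift_mem (-v₀) hz using 1
    ext p; simp
  · -- `ρ⁻¹(s) = v₀ + t` with `t ∈ square n`
    rw [mem_square] at hs
    have ht : rotM.symm s - v₀ ∈ square n := by
      rw [mem_square]; simp only [rotM_symm_apply, hv₀, Prod.mk_sub_mk]; omega
    have := hz1 _ ht
    simp only [shift_apply, Function.comp_apply] at this ⊢
    rw [show -v₀ + rotM.symm s = rotM.symm s - v₀ by abel, this, add_sub_cancel]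
    simp
  · rw [mem_square] at hs
    have ht : rotM.symm s - v₀ ∈ square n := by
      rw [mem_square]; simp only [rotM_symm_apply, hv₀, Prod.mk_sub_mk]; omega
    have := hz2 _ ht
    simp only [shift_apply, Function.comp_apply] at this ⊢
    rw [map_add, show -v₀ + (rotM.symm u' + rotM.symm s) = rotM.symm u' + (rotM.symm s - v₀) by abel,
      this, add_sub_cancel]
    simp

/-! ### Relabelling the alphabet -/

/-- Block gluing is preserved under relabelling of the alphabet along a bijection. [folklore] -/
theorem _root_.Literature.Dynamics.SymbolicDynamics.IsBlockGluing.comp_alphabet_equiv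
    {X : Set (ℤ × ℤ → A)} {f : ℕ → ℕ} (h : IsBlockGluing X f) (e : A ≃ B) :
    IsBlockGluing {x' : ℤ × ℤ → B | ⇑e.symm ∘ x' ∈ X} f := by
  intro n u hu x' hx' y' hy'
  obtain ⟨z, hz, hz1, hz2⟩ := h n u hu _ hx' _ hy'
  refine ⟨⇑e ∘ z, ?_, fun s hs => ?_, fun s hs => ?_⟩
  · show ⇑e.symm ∘ (⇑e ∘ z) ∈ X
    convert hz using 1
    funext w; simp
  · have := hz1 s hs
    simp only [Function.comp_apply] at this ⊢
    rw [this]; simp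
  · have := hz2 s hs
    simp only [Function.comp_apply] at this ⊢
    rw [this]; simp

/-- [folklore] -/
theorem _root_.Literature.Dynamics.SymbolicDynamics.IsLinearlyBlockGluing.comp_alphabet_equiv
    {X : Set (ℤ × ℤ → A)} (h : IsLinearlyBlockGluing X) (e : A ≃ B) :
    IsLinearlyBlockGluing {x' : ℤ × ℤ → B | ⇑e.symm ∘ x' ∈ X} := by
  obtain ⟨f, C, hf, hX⟩ := h
  exact ⟨f, C, hf, hX.comp_alphabet_equiv e⟩

/-! ### Arithmetic helpers -/

/-- [folklore] -/
theorem exists_lt_dvd_sub {N : ℕ} (hN : 1 ≤ N) (a : ℤ) : ∃ k : ℕ, k < N ∧ (N : ℤ) ∣ a - k := by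
  refine ⟨(a % N).toNat, ?_, ?_⟩
  · have h1 := Int.emod_nonneg a (show (N : ℤ) ≠ 0 by omega)
    have h2 := Int.emod_lt_of_pos a (show (0 : ℤ) < N by omega)
    omega
  · have h1 := Int.emod_nonneg a (show (N : ℤ) ≠ 0 by omega)
    rw [Int.toNat_of_nonneg h1]
    refine ⟨a / N, ?_⟩
    have := Int.emod_add_mul_ediv a N
    linarith

/-- [folklore] -/
theorem exists_lt_dvd_add {N : ℕ} (hN : 1 ≤ N) (a : ℤ) : ∃ k : ℕ, k < N ∧ (N : ℤ) ∣ a + k := by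
  obtain ⟨k, hk, hd⟩ := exists_lt_dvd_sub hN (-a)
  refine ⟨k, hk, ?_⟩
  rw [← dvd_neg, show -(a + k) = -a - k by ring]
  exact hd

/-- Reading a centred block out of an `m`-block, `m = 4n + 1`. [folklore] -/
theorem block_read {y : ℤ × ℤ → A} {P : ℤ × ℤ → A} {q c : ℤ × ℤ} (n : ℕ)
    (hy : ∀ s ∈ square (4 * n + 1), y (c + s) = shift (q - ((n : ℤ), 2 * (n : ℤ))) P s)
    (v : ℤ × ℤ) (h1 : |v.1| ≤ n) (h2 : |v.2| ≤ 2 * n) :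
    y (c + ((n : ℤ), 2 * (n : ℤ)) + v) = P (q + v) := by
  rw [abs_le] at h1 h2
  have hs : ((n : ℤ), 2 * (n : ℤ)) + v ∈ square (4 * n + 1) := by
    rw [mem_square]; simp only [Prod.fst_add, Prod.snd_add]; push_cast; omega
  have := hy _ hs
  rw [← add_assoc] at this
  rw [this, shift_apply]
  congr 1
  abel

/-! ### From net gluing to column gluing -/

section NetToCol

variable {Y : Set (ℤ × ℤ → A)} (hY : IsShiftInvariant Y)

include hY in
/-- **If `Y` is linearly net gluing then `d_A(Y)` is linearly column gluing** (Gangloff–Sablik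
Lemma 10 with Prop. 32: the columns `u.1 ≡ φ (mod N)` are glued at every height, the vertical
offset in `Y` being adjusted by the number of extra lines).
[cite: GangloffSablik2021, §5.4.3 Lemma 10 and Prop. 32] -/
theorem colGluing_distortion {C : ℕ} (hC : NetGluing Y C) : ColGluing (distortion Y) (500 * (C + 1)) := by
  intro n hn z₁ hz₁m z₂ hz₂m
  obtain ⟨n₂, hn₂, hnn₂, hn₂n⟩ : ∃ n₂ : ℕ, 2 ≤ n₂ ∧ n ≤ n₂ ∧ n₂ ≤ 2 * n :=
    ⟨max n 2, le_max_right _ _, le_max_left _ _, by omega⟩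
  obtain ⟨hz₁, x₁', hx₁', hP₁⟩ := hz₁m
  obtain ⟨hz₂, x₂', hx₂', hP₂⟩ := hz₂m
  have hPY₁ : proj hz₁ ∈ Y := by rwa [(isProj_proj hz₁).unique hz₁ hP₁]
  have hPY₂ : proj hz₂ ∈ Y := by rwa [(isProj_proj hz₂).unique hz₂ hP₂]
  obtain ⟨N, hN1, hNC, hnet⟩ := hC (4 * n₂ + 1) (by omega)
  set q₁ := coordOf hz₁ (baseCell hz₁) with hq₁
  set q₂ := coordOf hz₂ (baseCell hz₂) with hq₂
  set x₁ := shift (q₁ - ((n₂ : ℤ), 2 * (n₂ : ℤ))) (proj hz₁) with hx₁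
  set x₂ := shift (q₂ - ((n₂ : ℤ), 2 * (n₂ : ℤ))) (proj hz₂) with hx₂
  obtain ⟨w, y, hy, hy1, hy2⟩ := hnet x₁ (hY.shift_mem _ hPY₁) x₂ (hY.shift_mem _ hPY₂)
  have hNn : N ≤ 9 * C * n := le_trans hNC (by nlinarith)
  refine ⟨N, w.1, hN1, le_trans hNn (by nlinarith), fun u hu hdiv => ?_⟩
  have hNn' : (N : ℤ) ≤ 9 * C * n := by exact_mod_cast hNn
  -- the square of size `n` inside the square of size `n₂`
  have hsq : ∀ s ∈ square n, s ∈ square n₂ := fun s hs => by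
    rw [mem_square] at hs ⊢; omega
  -- reading the blocks of the pseudo-projections out of `y`
  have hread₁ : ∀ c : ℤ × ℤ, (∀ s ∈ square (4 * n₂ + 1), y (c + s) = x₁ s) →
      ∀ v : ℤ × ℤ, |v.1| ≤ n₂ → |v.2| ≤ 2 * n₂ →
        y (c + ((n₂ : ℤ), 2 * (n₂ : ℤ)) + v) = proj hz₁ (q₁ + v) := fun c hc => block_read n₂ hc
  have hread₂ : ∀ c : ℤ × ℤ, (∀ s ∈ square (4 * n₂ + 1), y (c + s) = x₂ s) →
      ∀ v : ℤ × ℤ, |v.1| ≤ n₂ → |v.2| ≤ 2 * n₂ →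
        y (c + ((n₂ : ℤ), 2 * (n₂ : ℤ)) + v) = proj hz₂ (q₂ + v) := fun c hc => block_read n₂ hc
  have hy0 : ∀ s ∈ square (4 * n₂ + 1), y (0 + s) = x₁ s := fun s hs => by rw [zero_add]; exact hy1 s hs
  -- bounds from `hu`
  have hthr : (220 * n₂ + 46 + 10 * N : ℤ) ≤ 500 * (C + 1) * n := by nlinarith
  have hu' : (220 * n₂ + 46 + 10 * N : ℤ) ≤ max |u.1| |u.2| := le_trans hthr hu
  -- the translate-back step for the mirrored cases
  have hback : ∀ z' ∈ distortion Y, (∀ s ∈ square n₂, z' s = z₂ s) → (∀ s ∈ square n₂, z' (-u + s) = z₁ s) →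
      ∃ z ∈ distortion Y, (∀ s ∈ square n, z s = z₁ s) ∧ ∀ s ∈ square n, z (u + s) = z₂ s := by
    intro z' hz' h1 h2
    refine ⟨shift (-u) z', isShiftInvariant_distortion hY (-u) hz', fun s hs => ?_, fun s hs => ?_⟩
    · rw [shift_apply]; exact h2 s (hsq s hs)
    · rw [shift_apply, neg_add_cancel_left]; exact h1 s (hsq s hs)
  obtain ⟨t₁, ht₁⟩ := hdiv
  -- case analysis on the position of `u`
  rcases le_or_gt (33 * n₂ + 7 + 2 * N : ℤ) u.2 with hA | hA
  · -- second block far above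
    obtain ⟨V₀, -, hcore⟩ := core_gap hY hn₂ N hz₁ hz₂ u hA
    obtain ⟨k, hk, t₂, ht₂⟩ := exists_lt_dvd_sub hN1 (V₀ - w.2)
    obtain ⟨z, hz, hz1, hz2⟩ := hcore k hk.le (shift ((n₂ : ℤ), 2 * (n₂ : ℤ)) y) (hY.shift_mem _ hy)
      (fun v hv1 hv2 => by
        rw [shift_apply, ← zero_add (((n₂ : ℤ), 2 * (n₂ : ℤ)) + v), ← add_assoc]
        exact hread₁ 0 hy0 v hv1 hv2)
      (fun v hv1 hv2 => by
        rw [shift_apply, show ((n₂ : ℤ), 2 * (n₂ : ℤ)) + ((u.1, V₀ - k) + v) =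
          (w + ((N : ℤ) * (t₁, t₂).1, (N : ℤ) * (t₁, t₂).2)) + ((n₂ : ℤ), 2 * (n₂ : ℤ)) + v by
            refine Prod.ext ?_ ?_ <;> simp <;> linarith]
        exact hread₂ _ (hy2 (t₁, t₂)) v hv1 hv2)
    exact ⟨z, hz, fun s hs => hz1 s (hsq s hs), fun s hs => hz2 s (hsq s hs)⟩
  rcases le_or_gt u.2 (-(33 * n₂ + 7 + 2 * N : ℤ)) with hB | hB
  · -- second block far below: glue `z₂` with `z₁` at `-u` and translate back
    obtain ⟨V₀, -, hcore⟩ := core_gap hY hn₂ N hz₂ hz₁ (-u) (by simp only [Prod.snd_neg]; linarith)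
    obtain ⟨k, hk, c₂, hc₂⟩ := exists_lt_dvd_sub hN1 (V₀ + w.2)
    set t : ℤ × ℤ := (t₁, -c₂) with ht
    have hzero : w + ((N : ℤ) * t.1, (N : ℤ) * t.2) + (-u.1, V₀ - k) = 0 := by
      refine Prod.ext ?_ ?_ <;> simp [ht] <;> linarith
    obtain ⟨z', hz', hz1, hz2⟩ := hcore k hk.le
      (shift (w + ((N : ℤ) * t.1, (N : ℤ) * t.2) + ((n₂ : ℤ), 2 * (n₂ : ℤ))) y) (hY.shift_mem _ hy)
      (fun v hv1 hv2 => by rw [shift_apply]; exact hread₂ _ (hy2 t) v hv1 hv2)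
      (fun v hv1 hv2 => by
        rw [shift_apply, show w + ((N : ℤ) * t.1, (N : ℤ) * t.2) + ((n₂ : ℤ), 2 * (n₂ : ℤ)) +
          (((-u).1, V₀ - k) + v) = 0 + ((n₂ : ℤ), 2 * (n₂ : ℤ)) + v by
            rw [← hzero]; simp only [Prod.fst_neg]; abel]
        exact hread₁ 0 hy0 v hv1 hv2)
    exact hback z' hz' hz1 hz2
  -- now `|u.2|` is small, so `|u.1|` is large
  have hu1 : (220 * n₂ + 46 + 10 * N : ℤ) ≤ |u.1| := by
    rcases le_max_iff.mp hu' with h | h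
    · exact h
    · exfalso; rw [le_abs] at h; rcases h with h | h <;> linarith
  rcases le_abs.mp hu1 with hD | hD
  · -- second block level, far to the right
    obtain ⟨V₀, hcore⟩ := core_level hY hn₂ N hz₁ hz₂ u (by linarith) hA hD
    obtain ⟨k, hk, t₂, ht₂⟩ := exists_lt_dvd_add hN1 (V₀ - w.2)
    obtain ⟨z, hz, hz1, hz2⟩ := hcore k hk.le (shift ((n₂ : ℤ), 2 * (n₂ : ℤ)) y) (hY.shift_mem _ hy)
      (fun v hv1 hv2 => by
        rw [shift_apply, ← zero_add (((n₂ : ℤ), 2 * (n₂ : ℤ)) + v), ← add_assoc]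
        exact hread₁ 0 hy0 v hv1 hv2)
      (fun v hv1 hv2 => by
        rw [shift_apply, show ((n₂ : ℤ), 2 * (n₂ : ℤ)) + ((u.1, V₀ + k) + v) =
          (w + ((N : ℤ) * (t₁, t₂).1, (N : ℤ) * (t₁, t₂).2)) + ((n₂ : ℤ), 2 * (n₂ : ℤ)) + v by
            refine Prod.ext ?_ ?_ <;> simp <;> linarith]
        exact hread₂ _ (hy2 (t₁, t₂)) v hv1 hv2)
    exact ⟨z, hz, fun s hs => hz1 s (hsq s hs), fun s hs => hz2 s (hsq s hs)⟩
  · -- second block level, far to the left: mirror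
    obtain ⟨V₀, hcore⟩ := core_level hY hn₂ N hz₂ hz₁ (-u) (by simp only [Prod.snd_neg]; linarith)
      (by simp only [Prod.snd_neg]; linarith) (by simp only [Prod.fst_neg]; linarith)
    obtain ⟨k, hk, c₂, hc₂⟩ := exists_lt_dvd_add hN1 (V₀ + w.2)
    set t : ℤ × ℤ := (t₁, -c₂) with ht
    have hzero : w + ((N : ℤ) * t.1, (N : ℤ) * t.2) + (-u.1, V₀ + k) = 0 := by
      refine Prod.ext ?_ ?_ <;> simp [ht] <;> linarith
    obtain ⟨z', hz', hz1, hz2⟩ := hcore k hk.le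
      (shift (w + ((N : ℤ) * t.1, (N : ℤ) * t.2) + ((n₂ : ℤ), 2 * (n₂ : ℤ))) y) (hY.shift_mem _ hy)
      (fun v hv1 hv2 => by rw [shift_apply]; exact hread₂ _ (hy2 t) v hv1 hv2)
      (fun v hv1 hv2 => by
        rw [shift_apply, show w + ((N : ℤ) * t.1, (N : ℤ) * t.2) + ((n₂ : ℤ), 2 * (n₂ : ℤ)) +
          (((-u).1, V₀ + k) + v) = 0 + ((n₂ : ℤ), 2 * (n₂ : ℤ)) + v by
            rw [← hzero]; simp only [Prod.fst_neg]; abel]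
        exact hread₁ 0 hy0 v hv1 hv2)
    exact hback z' hz' hz1 hz2

end NetToCol

/-! ### From row gluing to linear block gluing -/

section RowToBlock

variable {Y : Set (ℤ × ℤ → A)} (hY : IsShiftInvariant Y)

include hY in
/-- **If `Y` is linearly row gluing then `d_A(Y)` is linearly block gluing** (end of the proof of
Gangloff–Sablik Thm. 26: the rows `≡ φ (mod N)` of `Y` become curves; the construction realises,
for a fixed offset `u`, a whole interval of vertical offsets in `Y`, one of which is admissible).
[cite: GangloffSablik2021, §5.4.3, proof of Thm. 26] -/
theorem isLinearlyBlockGluing_distortion {C : ℕ} (hC : RowGluing Y C) :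
    IsLinearlyBlockGluing (distortion Y) := by
  refine ⟨fun n => 500 * (C + 1) * n, 500 * (C + 1), fun n => le_rfl, fun n u hu => ?_⟩
  rcases Nat.eq_zero_or_pos n with rfl | hn
  · intro x hx x' _
    exact ⟨x, hx, fun s hs => by simp [square] at hs, fun s hs => by simp [square] at hs⟩
  intro z₁ hz₁m z₂ hz₂m
  obtain ⟨n₂, hn₂, hnn₂, hn₂n⟩ : ∃ n₂ : ℕ, 2 ≤ n₂ ∧ n ≤ n₂ ∧ n₂ ≤ 2 * n :=
    ⟨max n 2, le_max_right _ _, le_max_left _ _, by omega⟩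
  obtain ⟨hz₁, x₁', hx₁', hP₁⟩ := hz₁m
  obtain ⟨hz₂, x₂', hx₂', hP₂⟩ := hz₂m
  have hPY₁ : proj hz₁ ∈ Y := by rwa [(isProj_proj hz₁).unique hz₁ hP₁]
  have hPY₂ : proj hz₂ ∈ Y := by rwa [(isProj_proj hz₂).unique hz₂ hP₂]
  set q₁ := coordOf hz₁ (baseCell hz₁) with hq₁
  set q₂ := coordOf hz₂ (baseCell hz₂) with hq₂
  set x₁ := shift (q₁ - ((n₂ : ℤ), 2 * (n₂ : ℤ))) (proj hz₁) with hx₁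
  set x₂ := shift (q₂ - ((n₂ : ℤ), 2 * (n₂ : ℤ))) (proj hz₂) with hx₂
  have hx₁Y : x₁ ∈ Y := hY.shift_mem _ hPY₁
  have hx₂Y : x₂ ∈ Y := hY.shift_mem _ hPY₂
  obtain ⟨N, φ, hN1, hNC, hrow⟩ := hC (4 * n₂ + 1) (by omega) x₁ hx₁Y x₂ hx₂Y
  obtain ⟨N', φ', hN1', hNC', hrow'⟩ := hC (4 * n₂ + 1) (by omega) x₂ hx₂Y x₁ hx₁Y
  -- the range of adjustment
  set K : ℕ := C * (4 * n₂ + 1) + N + N' with hK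
  have hKn : K ≤ 27 * C * n := by
    have h9 : C * (4 * n₂ + 1) ≤ C * (9 * n) := Nat.mul_le_mul_left C (by omega)
    rw [hK]
    nlinarith [h9, hNC, hNC']
  have hsq : ∀ s ∈ square n, s ∈ square n₂ := fun s hs => by
    rw [mem_square] at hs ⊢; omega
  have hread₁ : ∀ (y : ℤ × ℤ → A) (c : ℤ × ℤ), (∀ s ∈ square (4 * n₂ + 1), y (c + s) = x₁ s) →
      ∀ v : ℤ × ℤ, |v.1| ≤ n₂ → |v.2| ≤ 2 * n₂ →
        y (c + ((n₂ : ℤ), 2 * (n₂ : ℤ)) + v) = proj hz₁ (q₁ + v) := fun y c hc => block_read n₂ hc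
  have hread₂ : ∀ (y : ℤ × ℤ → A) (c : ℤ × ℤ), (∀ s ∈ square (4 * n₂ + 1), y (c + s) = x₂ s) →
      ∀ v : ℤ × ℤ, |v.1| ≤ n₂ → |v.2| ≤ 2 * n₂ →
        y (c + ((n₂ : ℤ), 2 * (n₂ : ℤ)) + v) = proj hz₂ (q₂ + v) := fun y c hc => block_read n₂ hc
  have hthr : (220 * n₂ + 46 + 10 * K : ℤ) ≤ ((n + 500 * (C + 1) * n : ℕ) : ℤ) := by
    push_cast; nlinarith
  have hu' : (220 * n₂ + 46 + 10 * K : ℤ) ≤ max |u.1| |u.2| := le_trans hthr hu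
  have hback : ∀ z' ∈ distortion Y, (∀ s ∈ square n₂, z' s = z₂ s) → (∀ s ∈ square n₂, z' (-u + s) = z₁ s) →
      ∃ z ∈ distortion Y, (∀ s ∈ square n, z s = z₁ s) ∧ ∀ s ∈ square n, z (u + s) = z₂ s := by
    intro z' hz' h1 h2
    refine ⟨shift (-u) z', isShiftInvariant_distortion hY (-u) hz', fun s hs => ?_, fun s hs => ?_⟩
    · rw [shift_apply]; exact h2 s (hsq s hs)
    · rw [shift_apply, neg_add_cancel_left]; exact h1 s (hsq s hs)
  have hCm : (C * (4 * n₂ + 1) : ℤ) ≤ K := by rw [hK]; push_cast; omega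
  -- case analysis on the position of `u`
  rcases le_or_gt (33 * n₂ + 7 + 2 * K : ℤ) u.2 with hA | hA
  · -- second block far above
    obtain ⟨V₀, hV₀, hcore⟩ := core_gap hY hn₂ K hz₁ hz₂ u hA
    obtain ⟨k, hk, hdk⟩ := exists_lt_dvd_sub hN1 (V₀ - φ)
    obtain ⟨y, hy, hy1, hy2⟩ := hrow (u.1, V₀ - k)
      (le_max_of_le_right (by rw [le_abs]; left; simp only; push_cast; linarith))
      (by simp only; convert hdk using 1; ring)
    have hy0 : ∀ s ∈ square (4 * n₂ + 1), y (0 + s) = x₁ s := fun s hs => by rw [zero_add]; exact hy1 s hs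
    obtain ⟨z, hz, hz1, hz2⟩ := hcore k (by omega) (shift ((n₂ : ℤ), 2 * (n₂ : ℤ)) y) (hY.shift_mem _ hy)
      (fun v hv1 hv2 => by
        rw [shift_apply, ← zero_add (((n₂ : ℤ), 2 * (n₂ : ℤ)) + v), ← add_assoc]
        exact hread₁ y 0 hy0 v hv1 hv2)
      (fun v hv1 hv2 => by
        rw [shift_apply, show ((n₂ : ℤ), 2 * (n₂ : ℤ)) + ((u.1, V₀ - k) + v) =
          (u.1, V₀ - k) + ((n₂ : ℤ), 2 * (n₂ : ℤ)) + v by abel]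
        exact hread₂ y _ hy2 v hv1 hv2)
    exact ⟨z, hz, fun s hs => hz1 s (hsq s hs), fun s hs => hz2 s (hsq s hs)⟩
  rcases le_or_gt u.2 (-(33 * n₂ + 7 + 2 * K : ℤ)) with hB | hB
  · -- second block far below: mirror
    obtain ⟨V₀, hV₀, hcore⟩ := core_gap hY hn₂ K hz₂ hz₁ (-u) (by simp only [Prod.snd_neg]; linarith)
    obtain ⟨k, hk, hdk⟩ := exists_lt_dvd_sub hN1' (V₀ - φ')
    simp only [Prod.snd_neg] at hV₀
    obtain ⟨y, hy, hy1, hy2⟩ := hrow' (-u.1, V₀ - k)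
      (le_max_of_le_right (by rw [le_abs]; left; simp only; push_cast; linarith))
      (by simp only; convert hdk using 1; ring)
    have hy0 : ∀ s ∈ square (4 * n₂ + 1), y (0 + s) = x₂ s := fun s hs => by rw [zero_add]; exact hy1 s hs
    obtain ⟨z', hz', hz1, hz2⟩ := hcore k (by omega) (shift ((n₂ : ℤ), 2 * (n₂ : ℤ)) y) (hY.shift_mem _ hy)
      (fun v hv1 hv2 => by
        rw [shift_apply, ← zero_add (((n₂ : ℤ), 2 * (n₂ : ℤ)) + v), ← add_assoc]
        exact hread₂ y 0 hy0 v hv1 hv2)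
      (fun v hv1 hv2 => by
        rw [shift_apply, show ((n₂ : ℤ), 2 * (n₂ : ℤ)) + (((-u).1, V₀ - k) + v) =
          (-u.1, V₀ - k) + ((n₂ : ℤ), 2 * (n₂ : ℤ)) + v by simp only [Prod.fst_neg]; abel]
        exact hread₁ y _ hy2 v hv1 hv2)
    exact hback z' hz' hz1 hz2
  have hu1 : (220 * n₂ + 46 + 10 * K : ℤ) ≤ |u.1| := by
    rcases le_max_iff.mp hu' with h | h
    · exact h
    · exfalso; rw [le_abs] at h; rcases h with h | h <;> linarith
  rcases le_abs.mp hu1 with hD | hD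
  · -- level, far to the right
    obtain ⟨V₀, hcore⟩ := core_level hY hn₂ K hz₁ hz₂ u (by linarith) hA hD
    obtain ⟨k, hk, hdk⟩ := exists_lt_dvd_add hN1 (V₀ - φ)
    obtain ⟨y, hy, hy1, hy2⟩ := hrow (u.1, V₀ + k)
      (le_max_of_le_left (by rw [le_abs]; left; simp only; push_cast; linarith))
      (by simp only; convert hdk using 1; ring)
    have hy0 : ∀ s ∈ square (4 * n₂ + 1), y (0 + s) = x₁ s := fun s hs => by rw [zero_add]; exact hy1 s hs
    obtain ⟨z, hz, hz1, hz2⟩ := hcore k (by omega) (shift ((n₂ : ℤ), 2 * (n₂ : ℤ)) y) (hY.shift_mem _ hy)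
      (fun v hv1 hv2 => by
        rw [shift_apply, ← zero_add (((n₂ : ℤ), 2 * (n₂ : ℤ)) + v), ← add_assoc]
        exact hread₁ y 0 hy0 v hv1 hv2)
      (fun v hv1 hv2 => by
        rw [shift_apply, show ((n₂ : ℤ), 2 * (n₂ : ℤ)) + ((u.1, V₀ + k) + v) =
          (u.1, V₀ + k) + ((n₂ : ℤ), 2 * (n₂ : ℤ)) + v by abel]
        exact hread₂ y _ hy2 v hv1 hv2)
    exact ⟨z, hz, fun s hs => hz1 s (hsq s hs), fun s hs => hz2 s (hsq s hs)⟩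
  · -- level, far to the left: mirror
    obtain ⟨V₀, hcore⟩ := core_level hY hn₂ K hz₂ hz₁ (-u) (by simp only [Prod.snd_neg]; linarith)
      (by simp only [Prod.snd_neg]; linarith) (by simp only [Prod.fst_neg]; linarith)
    obtain ⟨k, hk, hdk⟩ := exists_lt_dvd_add hN1' (V₀ - φ')
    obtain ⟨y, hy, hy1, hy2⟩ := hrow' (-u.1, V₀ + k)
      (le_max_of_le_left (by rw [le_abs]; left; simp only; push_cast; linarith))
      (by simp only; convert hdk using 1; ring)
    have hy0 : ∀ s ∈ square (4 * n₂ + 1), y (0 + s) = x₂ s := fun s hs => by rw [zero_add]; exact hy1 s hs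
    obtain ⟨z', hz', hz1, hz2⟩ := hcore k (by omega) (shift ((n₂ : ℤ), 2 * (n₂ : ℤ)) y) (hY.shift_mem _ hy)
      (fun v hv1 hv2 => by
        rw [shift_apply, ← zero_add (((n₂ : ℤ), 2 * (n₂ : ℤ)) + v), ← add_assoc]
        exact hread₂ y 0 hy0 v hv1 hv2)
      (fun v hv1 hv2 => by
        rw [shift_apply, show ((n₂ : ℤ), 2 * (n₂ : ℤ)) + (((-u).1, V₀ + k) + v) =
          (-u.1, V₀ + k) + ((n₂ : ℤ), 2 * (n₂ : ℤ)) + v by simp only [Prod.fst_neg]; abel]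
        exact hread₁ y _ hy2 v hv1 hv2)
    exact hback z' hz' hz1 hz2

end RowToBlock

end Literature.Dynamics.SymbolicDynamics.Distortion
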